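import Literature.Analysis.ValidatedNumerics.TaylorModel
import Literature.Analysis.ValidatedNumerics.ExpPoly.Poly
import HarnessLib

/-!
# Panel quadrature against a Taylor model

Trunk T-ANA (Analysis/ValidatedNumerics); namespace `Literature.Analysis.ValidatedNumerics.PolyMP`.
Sequel of `TaylorModel.lean` and `ExpPoly/Poly.lean`.  The certified evaluation of `∫ f(t) q(t) dt` for a
transcendental weight `f` (enclosed panel by panel by Taylor models) against an EXACT rational polynomial `q`
(typically of high degree with large coefficients — so that `q` must be re-centred on each panel, not
expanded at the origin): on one panel `|ρ| ≤ h`,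

  `|∫_{-h}^{h} f(ρ) q(ρ) dρ − ∫_{-h}^{h} p(ρ) q(ρ) dρ| ≤ (B/S) · 2h · Σₙ |qₙ| hⁿ`,

where `p` is any rational polynomial (in practice the midpoint polynomial of the Taylor model of `f`),
`B = tabsI S h (f − p)` is the kernel-computed scaled sup bound of `f − p`, and `∫ p q` is an exact rational
(`integPolyQ`, antiderivative `Poly.ad 0`).  Everything on the right is computable over `ℚ`.

* `ratPolyI S p`, `tmem_ratPoly` — a rational coefficient list as an exact Taylor model;
* `absBoundQ q h = Σ |qₙ| hⁿ` (Horner) with `abs_eval_le_absBoundQ`;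
* `integPolyQ p q h = ∫_{-h}^{h} p q` with `integral_eval_mul_eval`;
* `abs_integral_mul_sub_integPolyQ_le` — the displayed estimate.

Problem-independent; no facts, no axioms.

## References

* K. Makino, M. Berz, *Taylor models and other validated functional inclusion methods*, Int. J. Pure
  Appl. Math. 4 (2003) 379–456, §6 (validated integration). [folklore]
-/

open MeasureTheory intervalIntegral Set
open scoped Interval

namespace Literature.Analysis.ValidatedNumerics

namespace PolyMP

open Literature.Analysis.ValidatedNumerics.NumericsMP
open Literature.Analysis.ValidatedNumerics.ExpPoly (Poly)
open Literature.Analysis.ValidatedNumerics.ExpPoly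

/-! ### Rational polynomials as exact Taylor models -/

/-- The thin interval polynomial of a rational coefficient list. [folklore] -/
def ratPolyI (S : ℕ) (p : Poly) : IPoly := p.map (ofRat S)

/-- [folklore] -/
theorem pmem_ratPoly (S : ℕ) : ∀ p : Poly, PMem S (p.map ((↑) : ℚ → ℝ)) (ratPolyI S p)
  | [] => by simpa [ratPolyI] using pmem_nil S
  | c :: p => by simpa [ratPolyI] using pmem_cons (mem_ofRat S c) (pmem_ratPoly S p)

/-- A rational polynomial is enclosed (exactly) by its thin model, on any radius. [folklore] -/
theorem tmem_ratPoly (S : ℕ) (h : ℚ) (p : Poly) : TMem S h (fun ρ => Poly.eval p ρ) (ratPolyI S p) :=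
  fun ρ _ => ⟨p.map ((↑) : ℚ → ℝ), pmem_ratPoly S p, by simp only [Poly.eval_eq_evalR]⟩

/-! ### Absolute bound of a rational polynomial on `|y| ≤ h` -/

/-- `Σ |qₙ| hⁿ` in Horner form, over `ℚ`. [folklore] -/
def absBoundQ : Poly → ℚ → ℚ
  | [], _ => 0
  | c :: p, h => |c| + h * absBoundQ p h

/-- [folklore] -/
theorem absBoundQ_cast (h : ℚ) : ∀ p : Poly, ((absBoundQ p h : ℚ) : ℝ) = absBoundR (p.map ((↑) : ℚ → ℝ)) h
  | [] => by simp [absBoundQ, absBoundR]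
  | c :: p => by simp [absBoundQ, absBoundR, absBoundQ_cast h p]

/-- `|q(y)| ≤ absBoundQ q h` for `|y| ≤ h`. [folklore] -/
theorem abs_eval_le_absBoundQ (p : Poly) {y : ℝ} {h : ℚ} (hy : |y| ≤ h) :
    |Poly.eval p y| ≤ ((absBoundQ p h : ℚ) : ℝ) := by
  rw [Poly.eval_eq_evalR, absBoundQ_cast]
  exact abs_evalR_le_absBoundR _ hy

/-! ### Exact integral of a product of rational polynomials -/

/-- `∫_{-h}^{h} p(ρ) q(ρ) dρ` as an exact rational. [folklore] -/
def integPolyQ (p q : Poly) (h : ℚ) : ℚ :=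
  Poly.evalQ (Poly.ad 0 (Poly.mul p q)) h - Poly.evalQ (Poly.ad 0 (Poly.mul p q)) (-h)

/-- The antiderivative `ad 0 r` differentiates to `r` (the case `κ = θ = 0` of `Poly.hasDerivAt_ad`). [folklore] -/
theorem hasDerivAt_eval_ad_zero (r : Poly) (x : ℝ) :
    HasDerivAt (fun y => Poly.eval (Poly.ad 0 r) y) (Poly.eval r x) x := by
  have h := Poly.hasDerivAt_ad 0 0 r x
  simp only [Rat.cast_zero, zero_mul, zero_add, Real.exp_zero, mul_one] at h
  exact h

/-- [folklore] -/
theorem integral_eval_mul_eval (p q : Poly) (h : ℚ) :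
    ∫ ρ in (-(h : ℝ))..h, Poly.eval p ρ * Poly.eval q ρ = ((integPolyQ p q h : ℚ) : ℝ) := by
  have h1 : ∫ ρ in (-(h : ℝ))..h, Poly.eval p ρ * Poly.eval q ρ =
      ∫ ρ in (-(h : ℝ))..h, Poly.eval (Poly.mul p q) ρ :=
    integral_congr fun ρ _ => by simp only [Poly.eval_mul]
  rw [h1, integral_eq_sub_of_hasDerivAt (fun x _ => hasDerivAt_eval_ad_zero (Poly.mul p q) x)
    ((Poly.continuous_eval _).intervalIntegrable _ _), integPolyQ]
  rw [Rat.cast_sub, Poly.eval_evalQ, Poly.eval_evalQ]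
  push_cast
  ring

/-! ### The panel estimate -/

/-- **Panel quadrature against a Taylor model.**  If `P` encloses `f` on `|ρ| ≤ h` and `f` is interval
integrable there, then for all rational polynomials `p, q`,
`|∫_{-h}^{h} f q − ∫_{-h}^{h} p q| ≤ (tabsI S h (P − p)/S) · (2h · Σ|qₙ|hⁿ)`. [folklore] -/
theorem abs_integral_mul_sub_integPolyQ_le {S : ℕ} (hS : 0 < S) {h : ℚ} (h0 : 0 ≤ h) {f : ℝ → ℝ}
    {P : IPoly} (hf : TMem S h f P) (hfi : IntervalIntegrable f volume (-(h : ℝ)) h) (p q : Poly) :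
    |(∫ ρ in (-(h : ℝ))..h, f ρ * Poly.eval q ρ) - ((integPolyQ p q h : ℚ) : ℝ)| ≤
      (tabsI S h (tsubI P (ratPolyI S p)) : ℝ) / S * (2 * h * absBoundQ q h) := by
  set B : ℤ := tabsI S h (tsubI P (ratPolyI S p)) with hB
  have hSr : (0 : ℝ) < S := by exact_mod_cast hS
  have hq_cont : Continuous fun ρ => Poly.eval q ρ := Poly.continuous_eval q
  have hp_cont : Continuous fun ρ => Poly.eval p ρ := Poly.continuous_eval p
  have hfq : IntervalIntegrable (fun ρ => f ρ * Poly.eval q ρ) volume (-(h : ℝ)) h :=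
    hfi.mul_continuousOn hq_cont.continuousOn
  have hpq : IntervalIntegrable (fun ρ => Poly.eval p ρ * Poly.eval q ρ) volume (-(h : ℝ)) h :=
    (hp_cont.mul hq_cont).intervalIntegrable _ _
  rw [← integral_eval_mul_eval, ← integral_sub hfq hpq]
  -- pointwise bound on the panel
  have hdiff := tmem_sub hf (tmem_ratPoly S h p)
  have hpt : ∀ x ∈ Ι (-(h : ℝ)) h, ‖f x * Poly.eval q x - Poly.eval p x * Poly.eval q x‖ ≤
      (B : ℝ) / S * absBoundQ q h := by
    intro x hx
    have hh : (-(h : ℝ)) ≤ h := by linarith [(by exact_mod_cast h0 : (0 : ℝ) ≤ h)]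
    rw [uIoc_of_le hh] at hx
    have hxa : |x| ≤ h := abs_le.2 ⟨hx.1.le, hx.2⟩
    have h1 : |f x - Poly.eval p x| * S ≤ (B : ℝ) := abs_le_tabsI h0 hdiff hxa
    have h2 : |Poly.eval q x| ≤ ((absBoundQ q h : ℚ) : ℝ) := abs_eval_le_absBoundQ q hxa
    rw [Real.norm_eq_abs, ← sub_mul, abs_mul]
    have h1' : |f x - Poly.eval p x| ≤ (B : ℝ) / S := by rw [le_div_iff₀ hSr]; exact h1
    exact mul_le_mul h1' h2 (abs_nonneg _) (by
      have := abs_nonneg (f x - Poly.eval p x); exact le_trans this h1')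
  refine (norm_integral_le_of_norm_le_const hpt).trans (le_of_eq ?_)
  have : |(h : ℝ) - -(h : ℝ)| = 2 * h := by
    rw [sub_neg_eq_add, abs_of_nonneg (by positivity)]; ring
  rw [this]
  ring

end PolyMP

end Literature.Analysis.ValidatedNumerics
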